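import Mathlib.AlgebraicGeometry.SpreadingOut
import HarnessLib

/-!
# Germ equality implies local equality (Stacks 0BX6, packaged over `X.Opens`)

Support file for crux stmt-ResolutionOfSingularities-15317 (`FrobeniusLadder.FRationalResolution`),
line `Sketch`, continuation seat c3, cycle 9 (theme REC: Zariski-local recognition — k-isomorphic
stalks give isomorphic open neighbourhoods; goal: make the `A_n`-chart showcase intrinsic). This
file packages Mathlib's `spread_out_unique_of_isGermInjective'` for morphisms out of an OPEN
SUBSCHEME `A ⊆ X`: if two morphisms `a b : A → T` agree on the germ at `x ∈ A`
(`A.fromSpecStalkOfMem x _ ≫ a = A.fromSpecStalkOfMem x _ ≫ b`), they agree on a smaller open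
`x ∈ A₁ ≤ A` of `X` (`X.homOfLE _ ≫ a = X.homOfLE _ ≫ b`). [cite: StacksProject, Tag 0BX6]
-/

-- single-problem summit: the doubled namespace component is forced
set_option linter.dupNamespace false

noncomputable section

namespace Summit.ResolutionOfSingularities.ResolutionOfSingularities.Theorems.FRationalResolution

open CategoryTheory AlgebraicGeometry TopologicalSpace

universe u

set_option backward.isDefEq.respectTransparency false in
/-- The canonical map `Spec 𝒪_{X,x} → A` of an open `x ∈ A ⊆ X` is the germ map of the open
subscheme `A` at the point `⟨x, _⟩` precomposed with `Spec` of the (invertible) stalk map of `A.ι`.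
-/
theorem fromSpecStalk_opens_eq {X : Scheme.{u}} (A : X.Opens) (x : X) (hxA : x ∈ A) :
    (A : Scheme.{u}).fromSpecStalk ⟨x, hxA⟩ =
      Spec.map (A.ι.stalkMap ⟨x, hxA⟩) ≫ A.fromSpecStalkOfMem x hxA := by
  simp [Scheme.Opens.fromSpecStalkOfMem]

set_option backward.isDefEq.respectTransparency false in
/-- **Germ equality implies local equality, over `X.Opens`.** Let `X` be germ-injective at `x`
(e.g. integral or locally Noetherian), `x ∈ A` an open of `X`, and `a b : A → T` two morphisms with
`A.fromSpecStalkOfMem x _ ≫ a = A.fromSpecStalkOfMem x _ ≫ b`. Then there is an open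
`x ∈ A₁ ≤ A` of `X` with `X.homOfLE _ ≫ a = X.homOfLE _ ≫ b`. [cite: StacksProject, Tag 0BX6] -/
theorem exists_homOfLE_comp_eq_of_fromSpecStalkOfMem_comp_eq {X T : Scheme.{u}} {x : X}
    [X.IsGermInjectiveAt x] (A : X.Opens) (hxA : x ∈ A) (a b : (A : Scheme.{u}) ⟶ T)
    (hab : A.fromSpecStalkOfMem x hxA ≫ a = A.fromSpecStalkOfMem x hxA ≫ b) :
    ∃ (A₁ : X.Opens) (h₁ : A₁ ≤ A), x ∈ A₁ ∧ X.homOfLE h₁ ≫ a = X.homOfLE h₁ ≫ b := by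
  -- the open subscheme `A` is germ-injective at `⟨x, hxA⟩`
  haveI : (A : Scheme.{u}).IsGermInjectiveAt ⟨x, hxA⟩ := by
    have h := (isGermInjectiveAt_iff_of_isOpenImmersion (f := A.ι) (x := (⟨x, hxA⟩ : A))).mp
    exact h (by simpa using (inferInstance : X.IsGermInjectiveAt x))
  -- the germ maps of `A` and of `X` at `x` differ by an isomorphism
  have hab' : (A : Scheme.{u}).fromSpecStalk ⟨x, hxA⟩ ≫ a =
      (A : Scheme.{u}).fromSpecStalk ⟨x, hxA⟩ ≫ b := by
    rw [fromSpecStalk_opens_eq, Category.assoc, Category.assoc, hab]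
  obtain ⟨W, hxW, hW⟩ := spread_out_unique_of_isGermInjective' a b hab'
  refine ⟨A.ι ''ᵁ W, A.ι_image_le W, ⟨⟨x, hxA⟩, hxW, rfl⟩, ?_⟩
  rw [← Scheme.Opens.isoImage_ι_inv_ι, Category.assoc, Category.assoc, hW]

end Summit.ResolutionOfSingularities.ResolutionOfSingularities.Theorems.FRationalResolution

end
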